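import Summits.BirchSwinnertonDyer.Rank1Residual.X11a.AnomalousLineCohomology
import Literature.NumberTheory.EllipticCurves.OrdinaryLocalReductionMapProofs
import Literature.NumberTheory.GaloisRepresentations.FiniteCoefficients
import Literature.NumberTheory.GaloisRepresentations.ContinuousCohomologyConnecting
import HarnessLib

/-!
# Route (3e) SELMER COMPANION, XVIII-b: the Kummer classes of the kernel-of-reduction line at an
# ANOMALOUS good ordinary prime — at most `p` classes of `H¹(K_v, A)` come from `C`-valued cocycles
# (class X11a = N7; cell `b2b-bsdres`, unit `b2b-bsdres-x11a`, gens 28–29)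

HONEST FRAMING (run/shared/lean/b2b/bsd-rank1-residual/, verbatim in every file): the goal of the
cell is to DELETE the COMBINATION-SHAPED residual classes of the Birch–Swinnerton-Dyer formula for
ALL analytic-rank `≤ 1` elliptic curves over `ℚ` — "full BSD formula for every rank `≤ 1` curve in
class `C`" assembled STRICTLY from published theorems — so that the rank-`≤ 1` remainder becomes
exactly the CONSTRUCTION-SHAPED classes, which are TYPED (missing-input `Prop`s), NOT attempted.
This is not "finishing BSD". CLASS-OWNERS.md: research routes; NO CLAIM BEYOND STATED CLASSES.
THEOREMS ONLY; nothing booked; no label moves. CONDITIONAL on the PUBLISHED named fact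
`localEulerPoincareCharacteristic ℚ_v` (Milne *ADT* I Thm. 2.8, `hEP`) where it is a hypothesis.

## What (`exists_small_set_of_kernelValued_classes`)

`A/ℚ` globally minimal, good ORDINARY at `p`, `v ∣ p`, `C = A₁ ∩ A[p] ≤ A(K̄_v)` the
kernel-of-reduction line. File VII (gen 27) showed that when `C` is TWISTED as (α),(β) every
`C`-valued continuous crossed homomorphism is a coboundary in `A(K̄_v)`. At an ANOMALOUS prime
(`a_p(A) ≡ 1`, (β) fails, `#H¹(Γ, C) ≤ p²` by file XVII) this file proves what survives: **the
classes in `H¹(Γ_{K_v}, A(K̄_v))` of the `C`-valued continuous crossed homomorphisms form a set of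
at most `p` elements** ((α) only). Proof: `H¹(incl) : H¹(Γ, C) → H¹(Γ, A(K̄_v))` (the tree's
`cohomologyMap` of `subtypeHom`) kills the classes of the `p` Kummer cocycles `∂Q_i`, `pQ_i = i·u`,
`z(u) = p`, which are pairwise distinct by the level calculus of file VII; so its image has
`≤ p²/p = p` elements (`exists_small_set_of_classes_of_kernel`, stated for an arbitrary target
module so that no definitional comparison of coefficient modules is elaborated). Use (file
XVIII-c): the comparison index at `p` of a SPLIT multiplicative `E` with an anomalous good partner.

References: [GreenbergLNM1716] §2 Props. 2.2, 2.4; [SilvermanAEC2009] IV.3.2, VII.2.2;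
[MilneADT2006] I Thm. 2.8; [SerreGaloisCohomology1997] I.§2.2, §5.1; HOME/b2b-bsdres-x11a/REPORT-g29.md.
-/

set_option autoImplicit false

noncomputable section

open scoped Classical NNReal

open WeierstrassCurve Literature.NumberTheory.EllipticCurves
  Literature.NumberTheory.GaloisRepresentations Field NumberField IsDedekindDomain
  IsDedekindDomain.HeightOneSpectrum Literature.NumberTheory.EllipticCurves.FormalGroupChart

namespace Summit.BirchSwinnertonDyer.Rank1Residual.X11a.OrdinaryLine

variable {v : HeightOneSpectrum (𝓞 ℚ)} {p : ℕ} [hp : Fact p.Prime]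
  {w : Valuation (AlgebraicClosure (v.adicCompletion ℚ)) ℝ≥0}
  (hw : ∀ x, (w x : ℝ) =
    spectralNorm (v.adicCompletion ℚ) (AlgebraicClosure (v.adicCompletion ℚ)) x)
  (A : WeierstrassCurve ℚ) [A.IsGloballyMinimal]

/-- **Counting lemma for a change of coefficients on `H¹`.** Let `f : X ⟶ Y` be a morphism of
topological `Γ`-modules with `#H¹(Γ, X) ≤ p²`, and let `φ₀, …, φ_{p-1}` be continuous `1`-cocycles of
`X` with pairwise distinct classes whose images `f ∘ φ_i` are coboundaries of `Y`. Then the classes in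
`H¹(Γ, Y)` of the cocycles of the form `f ∘ ψ` (`ψ` a cocycle of `X`) form a set of at most `p`
elements: they are the image of `H¹(f)`, whose kernel has at least `p` elements. (Elementary; stated
for Mathlib's `continuousCohomology` and the tree's `cohomologyMap`, generically in `Y` so that no
definitional comparison of concrete coefficient modules is elaborated by its users.)
[cite: SerreGaloisCohomology1997, I.§2.2 and I.§5.1] -/
theorem exists_small_set_of_classes_of_kernel {Γ : Type} [Group Γ] [TopologicalSpace Γ]
    [IsTopologicalGroup Γ] {X Y : TopRep.{0} ℤ Γ} (f : X ⟶ Y) {p : ℕ} (hp : 0 < p)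
    [Finite (continuousCohomology 1 X)] (hX : Nat.card (continuousCohomology 1 X) ≤ p ^ 2)
    (φ : ℕ → contOneCocycles X)
    (hinj : Set.InjOn (fun i ↦ oneCocycleClass X (φ i)) ↑(Finset.range p))
    (hker : ∀ i, ∃ b : Y, ∀ σ, f.hom ((φ i).1 σ) = Y.ρ σ b - b) :
    ∃ S : Set (continuousCohomology 1 Y), S.Finite ∧ Nat.card S ≤ p ∧
      ∀ φY : contOneCocycles Y, (∃ ψ : contOneCocycles X, ∀ σ, f.hom (ψ.1 σ) = φY.1 σ) →
        oneCocycleClass Y φY ∈ S := by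
  let F : continuousCohomology 1 X →+ continuousCohomology 1 Y :=
    (cohomologyMap f 1).hom.toLinearMap.toAddMonoidHom
  have hFapp : ∀ x, F x = cohomologyMap f 1 x := fun x ↦ rfl
  have hF : ∀ ψ : contOneCocycles X, F (oneCocycleClass X ψ) =
      oneCocycleClass Y (contOneCocycles.pullback (ContinuousMonoidHom.id _) (resIdHom f) ψ) :=
    fun ψ ↦ by rw [hFapp]; exact cohomologyMap_oneCocycleClass f ψ
  have hφker : ∀ i, oneCocycleClass X (φ i) ∈ F.ker := by
    intro i
    obtain ⟨b, hb⟩ := hker i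
    rw [AddMonoidHom.mem_ker, hF]
    refine (oneCocycleClass_eq_zero_iff _ _).mpr ⟨b, fun σ ↦ ?_⟩
    rw [pullback_id_resIdHom_apply, hb]
  -- so `#ker F ≥ p` and `[H¹(Γ, X) : ker F] ≤ p² / p = p`
  haveI : Fintype (continuousCohomology 1 X) := Fintype.ofFinite _
  have hker_ge : p ≤ Nat.card F.ker := by
    have hinj' : Function.Injective (fun i : Fin p ↦
        (⟨oneCocycleClass X (φ i), hφker i⟩ : F.ker)) := by
      intro i j hij
      have h := congrArg Subtype.val hij
      exact Fin.ext (hinj (Finset.mem_coe.mpr (Finset.mem_range.mpr i.2))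
        (Finset.mem_coe.mpr (Finset.mem_range.mpr j.2)) h)
    have := Nat.card_le_card_of_injective _ hinj'
    rwa [Nat.card_eq_fintype_card, Fintype.card_fin] at this
  have hidx : F.ker.index ≤ p := by
    have h1 : F.ker.index * p ≤ p ^ 2 :=
      calc F.ker.index * p ≤ F.ker.index * Nat.card F.ker := Nat.mul_le_mul_left _ hker_ge
        _ = Nat.card (continuousCohomology 1 X) := AddSubgroup.index_mul_card F.ker
        _ ≤ p ^ 2 := hX
    rw [sq] at h1
    exact Nat.le_of_mul_le_mul_right h1 hp
  have hidx0 : F.ker.index ≠ 0 := AddSubgroup.index_ne_zero_of_finite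
  have hcS : Nat.card (F.range : Set (continuousCohomology 1 Y)) = F.ker.index :=
    (AddSubgroup.index_ker F).symm
  refine ⟨(F.range : Set (continuousCohomology 1 Y)), ?_, ?_, fun φY ⟨ψ, hψ⟩ ↦ ?_⟩
  · exact Nat.finite_of_card_ne_zero (by rw [hcS]; exact hidx0)
  · rw [hcS]; exact hidx
  · have hψY : contOneCocycles.pullback (ContinuousMonoidHom.id _) (resIdHom f) ψ = φY := by
      apply Subtype.ext
      ext σ
      rw [pullback_id_resIdHom_apply, hψ σ]
    refine ⟨oneCocycleClass X ψ, ?_⟩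
    rw [hF, hψY]


-- one long proof (the `C`-line, the level calculus and the count); not a search
set_option maxHeartbeats 800000 in
include hw in
/-- **At most `p` classes of `H¹(K_v, A)` come from `C`-valued cocycles** (`C = A₁ ∩ A[p]` the
kernel-of-reduction line of the globally minimal `A/ℚ`, good ordinary at the odd `p`, `v ∣ p`, with
(α): some `ι` acts by `2` on a non-zero point of `C`). See the module docstring.
[cite: GreenbergLNM1716, §2 Props. 2.2, 2.4] [cite: SilvermanAEC2009, Prop. IV.3.2 and Prop. VII.2.2]
[cite: MilneADT2006, Ch. I §2, Thm. 2.8] -/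
theorem exists_small_set_of_kernelValued_classes
    (hEP : localEulerPoincareCharacteristic (v.adicCompletion ℚ))
    (hpv : (p : 𝓞 ℚ) ∈ v.asIdeal) [A.IsElliptic]
    (hΔ : ¬ (p : ℤ) ∣ minimalDiscriminantInt A) (hord : ¬ (p : ℤ) ∣ A.frobeniusTrace p)
    [hV : (A.baseChange (AlgebraicClosure (v.adicCompletion ℚ))).IsIntegral w.integer]
    (hα : ∃ (ι : absoluteGaloisGroup (v.adicCompletion ℚ)) (T₁ : localPoints A (v.adicCompletion ℚ)),
      (p : ℤ) • T₁ = 0 ∧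
      (T₁ : (A.baseChange (AlgebraicClosure (v.adicCompletion ℚ))).toAffine.Point) ∈
        kernel w (A.baseChange (AlgebraicClosure (v.adicCompletion ℚ))) ∧
      T₁ ≠ 0 ∧ ι • T₁ = (2 : ℤ) • T₁) :
    ∃ S : Set (discreteH1 (absoluteGaloisGroup (v.adicCompletion ℚ))
        (localPoints A (v.adicCompletion ℚ))),
      S.Finite ∧ Nat.card S ≤ p ∧
      ∀ (φ : contOneCocycles (discreteTopRep (absoluteGaloisGroup (v.adicCompletion ℚ))
          (localPoints A (v.adicCompletion ℚ)))),
        (∀ σ, (p : ℤ) • φ.1 σ = 0) →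
        (∀ σ, (φ.1 σ : (A.baseChange (AlgebraicClosure (v.adicCompletion ℚ))).toAffine.Point) ∈ kernel w (A.baseChange (AlgebraicClosure (v.adicCompletion ℚ)))) →
        oneCocycleClass (discreteTopRep (absoluteGaloisGroup (v.adicCompletion ℚ))
          (localPoints A (v.adicCompletion ℚ))) φ ∈ S := by
  have hpp : p.Prime := hp.out
  haveI : NeZero p := ⟨hpp.ne_zero⟩
  -- NB: no `CharZero` instances here (they would re-route `Algebra ℚ _` instances over `ℚ`).
  obtain ⟨hp1, hp0⟩ := spectralValuation_natCast_prime_lt_one_and_pos (p := p) hw hpv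
  obtain ⟨𝔐, h𝔐⟩ := v.localPrimesAbove_nonempty
  have hϖ : Irreducible ((p : ℕ) : v.adicCompletionIntegers ℚ) :=
    irreducible_natCast_adicCompletionIntegers_rat hpv
  have hvO : w.Integers w.valuationSubring := Valuation.valuationSubring.integers w
  have hΔu := A.isUnit_Δ_localIntModel hpv hw hΔ
  let red₀ : localPoints A (v.adicCompletion ℚ) →+
      (((integralModelInt A).map (algebraMap ℤ ↥w.valuationSubring)).map
        (IsLocalRing.residue ↥w.valuationSubring)).toAffine.Point :=
    (goodReductionHom _ hvO hΔu).comp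
      (Affine.Point.congrEquiv (localIntModel_baseChange A w.valuationSubring).symm).toAddMonoidHom
  have hred₀ : ∀ P : localPoints A (v.adicCompletion ℚ), red₀ P =
      ((integralModelInt A).map (algebraMap ℤ ↥w.valuationSubring)).reducePoint
        (Affine.Point.congrEquiv (localIntModel_baseChange A w.valuationSubring).symm P) :=
    fun P ↦ rfl
  haveI hchar : CharP (IsLocalRing.ResidueField ↥w.valuationSubring) p := by
    refine (CharP.charP_iff_prime_eq_zero hpp).mpr ?_
    rw [← map_natCast (IsLocalRing.residue ↥w.valuationSubring), IsLocalRing.residue_eq_zero_iff,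
      IsLocalRing.mem_maximalIdeal, mem_nonunits_iff, hvO.isUnit_iff_valuation_eq_one]
    exact fun h ↦ absurd h (ne_of_lt (by simpa using hp1))
  have hker : ∀ P : localPoints A (v.adicCompletion ℚ), red₀ P = 0 ↔
      (P : (A.baseChange (AlgebraicClosure (v.adicCompletion ℚ))).toAffine.Point) ∈ kernel w (A.baseChange (AlgebraicClosure (v.adicCompletion ℚ))) :=
    fun P ↦ A.localRed_eq_zero_iff_mem_kernel hΔu red₀ hred₀ P
  have hstab : ∀ (σ : absoluteGaloisGroup (v.adicCompletion ℚ))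
      (Q : localPoints A (v.adicCompletion ℚ)), red₀ Q = 0 → red₀ (σ • Q) = 0 :=
    fun σ Q hQ ↦ (A.localRed_smul_eq_zero_iff hw hΔu red₀ hred₀ σ Q).mpr hQ
  obtain ⟨hgenr, -, hdiv₁⟩ := A.localRed_ordinary_filtration hΔu red₀ hred₀
    (A.exists_zsmul_eq_zero_localRed_ne_zero hw hΔu red₀ hred₀ hpv hΔ hord)
  let C : Submodule ℤ (localPoints A (v.adicCompletion ℚ)) :=
    { carrier := {T | red₀ T = 0 ∧ (p : ℤ) • T = 0}
      add_mem' := fun {a b} ha hb ↦ ⟨by rw [map_add, ha.1, hb.1, add_zero],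
        by rw [smul_add, ha.2, hb.2, add_zero]⟩
      zero_mem' := ⟨map_zero red₀, smul_zero _⟩
      smul_mem' := fun k T hT ↦ ⟨by rw [map_zsmul, hT.1]; exact zsmul_zero _,
        by rw [smul_comm, hT.2]; exact zsmul_zero _⟩ }
  have hmemC : ∀ T, T ∈ C ↔ red₀ T = 0 ∧ (p : ℤ) • T = 0 := fun T ↦ Iff.rfl
  have hCstab : ∀ σ : absoluteGaloisGroup (v.adicCompletion ℚ),
      C ≤ C.comap ((A.localGaloisModule (v.adicCompletion ℚ)) σ) := by
    intro σ T hT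
    rw [Submodule.mem_comap]
    change σ • T ∈ C
    exact ⟨hstab σ T hT.1, by rw [← smul_zsmul_localPoints, hT.2, smul_zero]⟩
  obtain ⟨P₁, hP₁0, hordP₁, hgenP₁⟩ := hgenr 1
  rw [pow_one] at hordP₁
  have hCeq : C.toAddSubgroup = AddSubgroup.zmultiples P₁ := by
    apply le_antisymm
    · intro T hT
      obtain ⟨c, rfl⟩ := hgenP₁ T hT.1 (by rw [pow_one]; exact hT.2)
      exact AddSubgroup.mem_zmultiples_iff.mpr ⟨c, natCast_zsmul _ _⟩
    · refine AddSubgroup.zmultiples_le_of_mem ⟨hP₁0, ?_⟩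
      rw [natCast_zsmul, ← hordP₁]
      exact addOrderOf_nsmul_eq_zero P₁
  have hcardC : Nat.card C = p := by
    change Nat.card C.toAddSubgroup = p; rw [hCeq, Nat.card_zmultiples, hordP₁]
  haveI hfinC : Finite C := Nat.finite_of_card_ne_zero (by rw [hcardC]; exact hpp.ne_zero)
  obtain ⟨hfinH, hcardH⟩ := natCard_H1_le_sq_of_line hEP hpv A C hCstab hcardC
    (by
      obtain ⟨ι, T₁, hpT₁, hkT₁, hT₁0, hι⟩ := hα
      exact ⟨ι, T₁, (hmemC T₁).mpr ⟨(hker T₁).mpr hkT₁, hpT₁⟩, hT₁0, hι⟩)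
  set X := (ContinuousRep.subrepresentation (A.localGaloisModule (v.adicCompletion ℚ)) C
    hCstab).toTopRep with hX
  -- continuous crossed homomorphisms with values in `C` as cocycles of `X`
  have mkCocycle : ∀ g : absoluteGaloisGroup (v.adicCompletion ℚ) →
      localPoints A (v.adicCompletion ℚ), Continuous g → (∀ σ τ, g (σ * τ) = g σ + σ • g τ) →
      (∀ σ, g σ ∈ C) → ∃ φ : contOneCocycles X,
        ∀ σ, ((φ.1 σ : C) : localPoints A (v.adicCompletion ℚ)) = g σ := by
    intro g hgc hg1 hgC
    refine ⟨⟨⟨fun σ ↦ ⟨g σ, hgC σ⟩, hgc.subtype_mk _⟩, fun σ τ ↦ ?_⟩, fun σ ↦ rfl⟩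
    apply Subtype.ext
    exact hg1 σ τ
  -- the rational point `u ∈ A₁(ℚ_v)` with local parameter `z(u) = p`
  have hbb : (A.baseChange (v.adicCompletion ℚ)).baseChange (AlgebraicClosure (v.adicCompletion ℚ)) = A.baseChange (AlgebraicClosure (v.adicCompletion ℚ)) :=
    (A.map_baseChange (IsScalarTower.toAlgHom ℚ (v.adicCompletion ℚ) (AlgebraicClosure (v.adicCompletion ℚ))) : _)
  haveI hV' : ((A.baseChange (v.adicCompletion ℚ)).baseChange (AlgebraicClosure (v.adicCompletion ℚ))).IsIntegral w.integer := by
    rw [hbb]; exact hV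
  set T : ((A.baseChange (v.adicCompletion ℚ)).baseChange (AlgebraicClosure (v.adicCompletion ℚ))).toAffine.Point ≃+
      localPoints A (v.adicCompletion ℚ) := Affine.Point.congrEquiv hbb with hTdef
  obtain ⟨P, hPker, hPz, hPfix⟩ :=
    exists_mem_kernel_zCoord_eq (w := w) (A.baseChange (v.adicCompletion ℚ)) hp1
  have hTsome : ∀ x y h, ∃ h', T (.some x y h) = .some x y h' := fun x y h ↦
    ⟨_, Affine.Point.congrEquiv_some hbb h⟩
  have hTz : ∀ Q : ((A.baseChange (v.adicCompletion ℚ)).baseChange (AlgebraicClosure (v.adicCompletion ℚ))).toAffine.Point,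
      ((T Q : localPoints A (v.adicCompletion ℚ)) : (A.baseChange (AlgebraicClosure (v.adicCompletion ℚ))).toAffine.Point).zCoord =
        Q.zCoord := by
    intro Q
    rcases Q with _ | ⟨x, y, h⟩
    · rw [← WeierstrassCurve.Affine.Point.zero_def, map_zero]; rfl
    · obtain ⟨h', e⟩ := hTsome x y h
      rw [e]; rfl
  have hTker : ∀ Q : ((A.baseChange (v.adicCompletion ℚ)).baseChange (AlgebraicClosure (v.adicCompletion ℚ))).toAffine.Point,
      Q ∈ kernel w ((A.baseChange (v.adicCompletion ℚ)).baseChange (AlgebraicClosure (v.adicCompletion ℚ))) →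
      ((T Q : localPoints A (v.adicCompletion ℚ)) : (A.baseChange (AlgebraicClosure (v.adicCompletion ℚ))).toAffine.Point) ∈
        kernel w (A.baseChange (AlgebraicClosure (v.adicCompletion ℚ))) := by
    intro Q hQ
    rcases Q with _ | ⟨x, y, h⟩
    · rw [← WeierstrassCurve.Affine.Point.zero_def, map_zero]; exact (kernel w _).zero_mem
    · obtain ⟨h', e⟩ := hTsome x y h
      rw [e]
      exact some_mem_kernel (w := w) h' ((some_mem_kernel_iff (w := w) h).mp hQ)
  have hTsmul : ∀ (σ : absoluteGaloisGroup (v.adicCompletion ℚ))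
      (Q : ((A.baseChange (v.adicCompletion ℚ)).baseChange (AlgebraicClosure (v.adicCompletion ℚ))).toAffine.Point),
      σ • (T Q : localPoints A (v.adicCompletion ℚ)) =
        T (Affine.Point.map (show (AlgebraicClosure (v.adicCompletion ℚ)) ≃ₐ[v.adicCompletion ℚ] (AlgebraicClosure (v.adicCompletion ℚ)) from σ :
          (AlgebraicClosure (v.adicCompletion ℚ)) →ₐ[v.adicCompletion ℚ] (AlgebraicClosure (v.adicCompletion ℚ))) Q) := by
    intro σ Q
    rcases Q with _ | ⟨x, y, h⟩
    · rw [← WeierstrassCurve.Affine.Point.zero_def, Affine.Point.map_zero, map_zero]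
      exact smul_zero σ
    · obtain ⟨h', e⟩ := hTsome x y h
      rw [e, Affine.Point.map_some, localPoints.smul_def, Affine.Point.map_some]
      obtain ⟨h'', e'⟩ := hTsome _ _ ((WeierstrassCurve.Affine.baseChange_nonsingular
        (W := (A.baseChange (v.adicCompletion ℚ)).toAffine)
        (show (AlgebraicClosure (v.adicCompletion ℚ)) ≃ₐ[v.adicCompletion ℚ] (AlgebraicClosure (v.adicCompletion ℚ)) from σ : (AlgebraicClosure (v.adicCompletion ℚ)) →ₐ[v.adicCompletion ℚ] (AlgebraicClosure (v.adicCompletion ℚ))).injective ..).mpr h)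
      rw [e']
      rfl
  set u : localPoints A (v.adicCompletion ℚ) := T P with hudef
  have hufix : ∀ σ : absoluteGaloisGroup (v.adicCompletion ℚ), σ • u = u := fun σ ↦ by
    rw [hudef, hTsmul, hPfix σ (fun z ↦ spectralValuation_smul hw σ z) (by rw [map_natCast])]
  have huker : (u : (A.baseChange (AlgebraicClosure (v.adicCompletion ℚ))).toAffine.Point) ∈ kernel w (A.baseChange (AlgebraicClosure (v.adicCompletion ℚ))) := hTker P hPker
  have huz : w (u : (A.baseChange (AlgebraicClosure (v.adicCompletion ℚ))).toAffine.Point).zCoord = w (p : (AlgebraicClosure (v.adicCompletion ℚ))) := by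
    rw [hudef, hTz, hPz]
  have hured : red₀ u = 0 := (hker u).mpr huker
  -- `p`-th roots `Q i` of the multiples `i • u` inside `A₁`
  choose Q hQ using fun i : ℕ ↦ hdiv₁ (i • u) (by rw [map_nsmul, hured]; exact nsmul_zero _)
  have hdC : ∀ (i : ℕ) (σ : absoluteGaloisGroup (v.adicCompletion ℚ)), σ • Q i - Q i ∈ C := by
    intro i σ
    refine ⟨by rw [map_sub, hstab σ _ (hQ i).1, (hQ i).1, sub_zero], ?_⟩
    rw [smul_sub, ← smul_zsmul_localPoints, natCast_zsmul, (hQ i).2, sub_eq_zero,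
      ← natCast_zsmul, smul_zsmul_localPoints, hufix]
  choose φ hφ using fun i : ℕ ↦ mkCocycle (fun σ ↦ σ • Q i - Q i)
    ((continuous_smul_localPoints A (v.adicCompletion ℚ) (Q i)).sub continuous_const)
    (fun σ τ ↦ by rw [mul_smul, smul_sub]; abel) (hdC i)
  -- two cocycles of `X` with the same class differ by a principal one
  have hsub_class : ∀ ψ₁ ψ₂ : contOneCocycles X,
      oneCocycleClass X ψ₁ = oneCocycleClass X ψ₂ →
        ∃ c : C, ∀ σ, ((ψ₁.1 σ : C) : localPoints A (v.adicCompletion ℚ)) -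
          ((ψ₂.1 σ : C) : localPoints A (v.adicCompletion ℚ)) =
          σ • (c : localPoints A (v.adicCompletion ℚ)) - (c : localPoints A (v.adicCompletion ℚ)) := by
    intro ψ₁ ψ₂ h
    have h0 : oneCocycleClass X (ψ₁ - ψ₂) = 0 := by
      have := map_sub (oneCocycleClassₗ X) ψ₁ ψ₂
      rw [oneCocycleClassₗ_apply, oneCocycleClassₗ_apply, oneCocycleClassₗ_apply, h, sub_self]
        at this
      exact this
    obtain ⟨c, hc⟩ := (oneCocycleClass_eq_zero_iff X _).mp h0
    refine ⟨c, fun σ ↦ ?_⟩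
    have h1 := congrArg (fun x : C ↦ (x : localPoints A (v.adicCompletion ℚ))) (hc σ)
    exact h1
  -- the Kummer classes `[∂Q_i]`, `i < p`, are pairwise distinct (level calculus on `A₁`)
  have hkey : ∀ i j : ℕ, j < p → i < j →
      oneCocycleClass X (φ j) = oneCocycleClass X (φ i) → False := by
    intro i j hj hij heq
    obtain ⟨c, hc⟩ := hsub_class (φ j) (φ i) heq
    set R : localPoints A (v.adicCompletion ℚ) :=
      Q j - Q i - (c : localPoints A (v.adicCompletion ℚ)) with hRdef
    have hRfix : ∀ σ : absoluteGaloisGroup (v.adicCompletion ℚ), σ • R = R := by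
      intro σ
      have h1 := hc σ
      rw [hφ j σ, hφ i σ] at h1
      rw [hRdef, smul_sub, smul_sub]
      have h2 : σ • Q j - σ • Q i - σ • (c : localPoints A (v.adicCompletion ℚ)) -
          (Q j - Q i - (c : localPoints A (v.adicCompletion ℚ))) = 0 := by
        rw [show σ • Q j - σ • Q i - σ • (c : localPoints A (v.adicCompletion ℚ)) -
          (Q j - Q i - (c : localPoints A (v.adicCompletion ℚ))) =
          (σ • Q j - Q j) - (σ • Q i - Q i) -
            (σ • (c : localPoints A (v.adicCompletion ℚ)) - (c : localPoints A (v.adicCompletion ℚ)))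
          by abel, h1, sub_self]
      exact sub_eq_zero.mp h2
    have hRred : red₀ R = 0 := by
      rw [hRdef, map_sub, map_sub, (hQ j).1, (hQ i).1, c.2.1, sub_zero, sub_zero]
    have hRker : (R : (A.baseChange (AlgebraicClosure (v.adicCompletion ℚ))).toAffine.Point) ∈ kernel w (A.baseChange (AlgebraicClosure (v.adicCompletion ℚ))) :=
      (hker R).mp hRred
    obtain ⟨d, hd⟩ : ∃ d : ℕ, j = i + d := ⟨j - i, by omega⟩
    have hd0 : 0 < d := by omega
    have hdp : ¬ p ∣ d := fun h ↦ by have : p ≤ d := Nat.le_of_dvd hd0 h; omega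
    have hpR : p • R = d • u := by
      rw [hRdef, smul_sub, smul_sub, (hQ j).2, (hQ i).2, hd, add_nsmul, ← natCast_zsmul c.1 p,
        c.2.2, sub_zero, add_sub_cancel_left]
    obtain ⟨uP, huP⟩ : ∃ uP : (A.baseChange (AlgebraicClosure (v.adicCompletion ℚ))).toAffine.Point,
        uP = u := ⟨u, rfl⟩
    obtain ⟨RP, hRP⟩ : ∃ RP : (A.baseChange (AlgebraicClosure (v.adicCompletion ℚ))).toAffine.Point,
        RP = R := ⟨R, rfl⟩
    have huPker : uP ∈ kernel w (A.baseChange (AlgebraicClosure (v.adicCompletion ℚ))) := by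
      rw [huP]; exact huker
    have huPz : w uP.zCoord = w (p : (AlgebraicClosure (v.adicCompletion ℚ))) := by
      rw [huP]; exact huz
    have hRPker : RP ∈ kernel w (A.baseChange (AlgebraicClosure (v.adicCompletion ℚ))) := by
      rw [hRP]; exact hRker
    have hpRP : p • RP = d • uP := by rw [hRP, huP]; exact hpR
    -- `|z(R)| ≤ |p|`, so `|z(pR)| ≤ |p|²`
    have hzR : w RP.zCoord ≤ w (p : (AlgebraicClosure (v.adicCompletion ℚ))) := by
      rw [hRP]; exact val_zCoord_le_of_forall_smul_eq (p := p) hw h𝔐 hϖ hRker hRfix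
    obtain ⟨-, -, hest⟩ := val_zCoord_nsmul (w := w)
      (V := A.baseChange (AlgebraicClosure (v.adicCompletion ℚ))) p hRPker
    have hzpR : w (p • RP).zCoord ≤ w (p : (AlgebraicClosure (v.adicCompletion ℚ))) ^ 2 := by
      have e : (p • RP).zCoord = ((p • RP).zCoord -
          (p : (AlgebraicClosure (v.adicCompletion ℚ))) * RP.zCoord) +
          (p : (AlgebraicClosure (v.adicCompletion ℚ))) * RP.zCoord := by ring
      rw [e]
      refine (Valuation.map_add w _ _).trans (max_le (hest.trans ?_) ?_)
      · rw [sq, sq]; exact mul_le_mul' hzR hzR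
      · rw [map_mul, sq]; exact mul_le_mul' le_rfl hzR
    -- `|z(d u)| = |p|`
    have hd1 : w (d : (AlgebraicClosure (v.adicCompletion ℚ))) = 1 :=
      spectralValuation_natCast_eq_one_of_not_dvd hpv hw hdp
    have hzdu : w (d • uP).zCoord = w (p : (AlgebraicClosure (v.adicCompletion ℚ))) := by
      rw [val_zCoord_nsmul_eq_of_lt (w := w) d huPker (by rw [huPz, hd1]; exact hp1), hd1, one_mul,
        huPz]
    have hcontra : w (p : (AlgebraicClosure (v.adicCompletion ℚ))) ≤
        w (p : (AlgebraicClosure (v.adicCompletion ℚ))) ^ 2 :=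
      calc w (p : (AlgebraicClosure (v.adicCompletion ℚ))) = w (d • uP).zCoord := hzdu.symm
        _ = w (p • RP).zCoord := by rw [hpRP]
        _ ≤ w (p : (AlgebraicClosure (v.adicCompletion ℚ))) ^ 2 := hzpR
    have hlt : w (p : (AlgebraicClosure (v.adicCompletion ℚ))) ^ 2 <
        w (p : (AlgebraicClosure (v.adicCompletion ℚ))) := by
      rw [sq]; exact mul_lt_of_lt_one_left hp0 hp1
    exact absurd hcontra (not_le.mpr hlt)
  have hinj : Set.InjOn (fun i ↦ oneCocycleClass X (φ i)) ↑(Finset.range p) := by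
    intro i hi j hj hij
    rw [Finset.coe_range, Set.mem_Iio] at hi hj
    rcases lt_trichotomy i j with h | h | h
    · exact (hkey i j hj h hij.symm).elim
    · exact h
    · exact (hkey j i hi h hij).elim
  haveI : Finite (continuousCohomology 1 X) := hfinH
  -- the inclusion `C ≤ A(K̄_v)` as a morphism to the discrete module `A(K̄_v)` of `Sha.lean` (the two
  -- `TopRep` structures on `A(K̄_v)` agree definitionally, `toTopRep_localGaloisModule`)
  haveI := absoluteGaloisGroup_compactSpace (v.adicCompletion ℚ)
  let hconv : (X ⟶ (A.localGaloisModule (v.adicCompletion ℚ)).toTopRep) →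
      (X ⟶ discreteTopRep (absoluteGaloisGroup (v.adicCompletion ℚ))
        (localPoints A (v.adicCompletion ℚ))) :=
    fun f ↦ f
  let ι : X ⟶ discreteTopRep (absoluteGaloisGroup (v.adicCompletion ℚ))
      (localPoints A (v.adicCompletion ℚ)) :=
    hconv (subtypeHom (A.localGaloisModule (v.adicCompletion ℚ)) C hCstab)
  have hιapp : ∀ c : C, ι.hom c = (c : localPoints A (v.adicCompletion ℚ)) := fun c ↦ rfl
  obtain ⟨S, hSfin, hScard, hS⟩ := exists_small_set_of_classes_of_kernel ι hpp.pos hcardH φ hinj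
    (fun i ↦ ⟨Q i, fun σ ↦ by
    rw [hιapp, hφ i σ, discreteTopRep_ρ_apply]⟩)
  refine ⟨S, hSfin, hScard, fun φY hfp hfk ↦ ?_⟩
  have hf1 : ∀ σ τ, φY.1 (σ * τ) = φY.1 σ + σ • φY.1 τ := fun σ τ ↦ by
    have h := φY.2 σ τ
    rwa [discreteTopRep_ρ_apply] at h
  obtain ⟨ψ, hψ⟩ := mkCocycle φY.1 φY.1.continuous hf1
    (fun σ ↦ (hmemC _).mpr ⟨(hker _).mpr (hfk σ), hfp σ⟩)
  exact hS φY ⟨ψ, fun σ ↦ by rw [hιapp, hψ σ]⟩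

end Summit.BirchSwinnertonDyer.Rank1Residual.X11a.OrdinaryLine

end
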